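import Summits.Ventures.PackingBounds.Energy.TenPointCkEightDefs
import HarnessLib

/-!
# `TenPointCkEight`: the value of the bound `10(9c - F(1,1,1) - A(1)) = 9608215/46656`

Framing: lottery ticket; floor = certified bounds/negative ranges. Venture `PackingBounds`, cell
`pub-packcert`, energy family E3PT (pub-packcert-energy gen 13; n = 4 kernel route = KERNEL-D6 data route + `threePointF 4`).
-/

noncomputable section

namespace Summit.Ventures.PackingBounds.Energy.TenPointCkEight

set_option maxRecDepth 20000 in
set_option maxHeartbeats 400000000 in
/-- The value of the bound: `10(9c - F(1,1,1) - A(1)) = 9608215/46656` (the `(1+t)^8`-energy of the configuration 'Petersen code (4,10,1/6)' over ordered pairs). -/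
theorem bound_eqT8 : (10 : ℝ) * ((10 - 1) * c0KT8 - FexpKT8 1 1 1 - aPolyKT8 1) = ((9608215 : ℝ)/46656) := by
  unfold c0KT8 FexpKT8 aPolyKT8 a1KT8 a2KT8; ring

end Summit.Ventures.PackingBounds.Energy.TenPointCkEight
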